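import Literature.Computability.Cryptography.HallgrenPellQuantum
import HarnessLib

/-!
# Hallgren's regulator algorithm over an abstract infrastructure, II: the classical post-processing

Topic `Computability/Cryptography`; the generic content of `HallgrenPellQuantum.lean` (Jozsa 2003, §10,
Thm. 6 (c) and Thm. 7: checking the candidates and selecting the least accepted one), made ABSTRACT IN THE
INSTANCE, companion of `HallgrenRegulatorGenericSampling.lean`. The cycle is any `G : GiantStepCycle ι`, the
candidate test is any Boolean function `passes` with `passes m ↔ G.Passes (m/N) (4/N) s₀ T (2M)`
(`N = Ngrid n`, `T = Tdbl n`), the acceptance is `acc m = [12 ≤ m] ∧ passes m`, and the numeric facts of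
the instance are hypotheses. Theorem-only file, no named facts, no definitions (the post-processor is the
explicit expression in the statements).

* `acc_sound_gen` — an accepted candidate is within `10` of `l S`, `l ≥ 1` (`G.passes_sound`, precision
  `N (E_tot + 2η) ≤ 2`); `acc_complete_gen` — a candidate within `1` of `S = N R` is accepted
  (`G.passes_complete`; `L ≥ 1/16`, `N ≥ 4096`);
* `exists_good_cand_gen` — if the characters of a pair of units are a coprime pair of small harmonics,
  Legendre's theorem lists a candidate within `1` of `S` among `allCands` (`exists_mem_numsOf_round`);
* `minAcc_filter_spec_gen`, **`post_correct_gen`** — the least accepted candidate is then within `10` of `S`;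
* `acc_str_gen`, `sel_str_gen`, `post_str_gen`, **`exists_post_fn_gen`** — for a polynomial-time test
  `passes : {0,1}* × ℕ → Bool` the post-processor `⟨w, v⟩ ↦ ⟨bin m₀, ε⟩` (least accepted candidate of
  `allCands |w| v`, empty if none) is a function in `FP`.

## References

* R. Jozsa, *Notes on Hallgren's efficient quantum algorithm for solving Pell's equation*,
  arXiv:quant-ph/0302134 (2003), §10 Thm. 6 (proof, requirement (c)), Thm. 7. [Jozsa2003]
* G. H. Hardy, E. M. Wright, *An Introduction to the Theory of Numbers*, 6th ed. (2008), Thm. 184. [HardyWright2008]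
* E. Bernstein, U. Vazirani, SIAM J. Comput. 26 (1997), §8. [BernsteinVazirani1997]
-/

noncomputable section

namespace Literature.Computability.Cryptography

namespace HallgrenQuantum

open _root_.Computability Complexity Complexity.CodeFP PeriodFinding Finset WalkData Polynomial

/-! ### Soundness and completeness of the acceptance -/

section Acceptance

variable {ι : Type*} (G : GiantStepCycle ι) (n s₀ M : ℕ) (passes : ℕ → Bool)

/-- `Efin ≤ Etot`. [folklore] -/
theorem Efin_le_Etot_gen : G.Efin s₀ (Tdbl n) (2 * M) ≤ G.Etot s₀ (Tdbl n) (2 * M) := by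
  unfold GiantStepCycle.Efin GiantStepCycle.Etot
  have := G.η_nonneg
  push_cast; nlinarith

/-- **Soundness of acceptance**: an accepted candidate (`12 ≤ m`, `passes m`) is within `10` of a positive
multiple of `S = N R`. [cite: Jozsa2003, §10 (proof of Thm. 6, requirement (c))] -/
theorem acc_sound_gen
    (hpass : ∀ m : ℕ, passes m = true ↔
      G.Passes (((m : ℤ) : ℚ) / (Ngrid n : ℚ)) ((4 : ℚ) / (Ngrid n : ℚ)) s₀ (Tdbl n) (2 * M))
    (hEtot : (Ngrid n : ℝ) * (G.Etot s₀ (Tdbl n) (2 * M) + 2 * G.η) ≤ 2)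
    {m : ℕ} (h : (decide (12 ≤ m) && passes m) = true) :
    ∃ l : ℤ, 1 ≤ l ∧ |(m : ℝ) - l * (Ngrid n * G.R)| ≤ 10 := by
  rw [Bool.and_eq_true, decide_eq_true_iff, hpass] at h
  obtain ⟨h12, hP⟩ := h
  obtain ⟨l, hl, hl1⟩ := G.passes_sound hP
  have hE := Efin_le_Etot_gen G n s₀ M
  have hN := Ngrid_ge n
  have hN0 : (0 : ℝ) < Ngrid n := by linarith
  have hη0 := G.η_nonneg
  set E := G.Efin s₀ (Tdbl n) (2 * M)
  have hEN : (Ngrid n : ℝ) * (E + 2 * G.η) ≤ 2 := by nlinarith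
  have hcastx : (((((m : ℤ) : ℚ) / (Ngrid n : ℚ)) : ℚ) : ℝ) = (m : ℝ) / Ngrid n := by push_cast; rfl
  have hcastΔ : ((((4 : ℚ) / (Ngrid n : ℚ)) : ℚ) : ℝ) = 4 / Ngrid n := by push_cast; rfl
  rw [hcastx, hcastΔ] at hl hl1
  refine ⟨l, hl1 ?_, ?_⟩
  · -- `8/N + E + 2η ≤ 10/N < 12/N ≤ m/N`
    have hm : (12 : ℝ) ≤ m := by exact_mod_cast h12
    rw [lt_div_iff₀ hN0]
    have e : (2 * (4 / (Ngrid n : ℝ)) + E + 2 * G.η) * Ngrid n = 8 + Ngrid n * (E + 2 * G.η) := by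
      field_simp; ring
    rw [e]; linarith
  · have hmul : |(m : ℝ) - l * (Ngrid n * G.R)| = Ngrid n * |(m : ℝ) / Ngrid n - l * G.R| := by
      rw [← abs_of_pos hN0, ← abs_mul, abs_of_pos hN0]; congr 1; field_simp
    rw [hmul]
    calc (Ngrid n : ℝ) * |(m : ℝ) / Ngrid n - l * G.R|
        ≤ Ngrid n * (2 * (4 / Ngrid n) + E + 2 * G.η) := mul_le_mul_of_nonneg_left hl hN0.le
      _ = 8 + Ngrid n * (E + 2 * G.η) := by field_simp; ring
      _ ≤ 10 := by linarith

/-- **Completeness of acceptance**: a candidate within `1` of `S` is accepted (`passes_complete` at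
`l = 1`, `δ = 1/N`: `1/N + E + 2η < 4/N ≤ m/N`, `4/N + E + η + 1/N ≤ 7/4096 < 1/16 ≤ L`).
[cite: Jozsa2003, §10 (proof of Thm. 6, requirement (c)) with §9 Thm. 5] -/
theorem acc_complete_gen
    (hpass : ∀ m : ℕ, passes m = true ↔
      G.Passes (((m : ℤ) : ℚ) / (Ngrid n : ℚ)) ((4 : ℚ) / (Ngrid n : ℚ)) s₀ (Tdbl n) (2 * M))
    (hstart : 2 * G.K + 1 ≤ (G.start s₀).2) (hRes : G.Res s₀ (Tdbl n) < M * (G.L - 2 * G.η))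
    (hEtot : (Ngrid n : ℝ) * (G.Etot s₀ (Tdbl n) (2 * M) + 2 * G.η) ≤ 2)
    (hS : (5000 : ℝ) ≤ Ngrid n * G.R) (hQ3 : 3 * ((Ngrid n : ℝ) * G.R) ^ 2 ≤ (2 : ℝ) ^ LQ n)
    (hL : (1 : ℝ) / 16 ≤ G.L) {m : ℕ} (hm : |(Ngrid n * G.R) - m| < 1) :
    (decide (12 ≤ m) && passes m) = true := by
  have hN := Ngrid_ge n
  have hN0 : (0 : ℝ) < Ngrid n := by linarith
  have hm12 : 12 ≤ m := by
    have : (11 : ℝ) < m := by rw [abs_lt] at hm; linarith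
    exact_mod_cast (show (11 : ℕ) < m by exact_mod_cast this)
  rw [Bool.and_eq_true, decide_eq_true_iff, hpass]
  refine ⟨hm12, ?_⟩
  have hE := Efin_le_Etot_gen G n s₀ M
  have hη0 := G.η_nonneg
  set E := G.Efin s₀ (Tdbl n) (2 * M)
  have hEN : (Ngrid n : ℝ) * (E + 2 * G.η) ≤ 2 := by nlinarith
  have hE0 : 0 ≤ E := G.Efin_nonneg _ _ _
  refine G.passes_complete s₀ (l := 1) (δ := 1 / Ngrid n) ?_ ?_ hRes ?_ ?_ ?_
  · -- `4/N ≤ m/N`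
    have : (4 : ℚ) ≤ ((m : ℤ) : ℚ) := by exact_mod_cast (show (4 : ℤ) ≤ m by exact_mod_cast (by omega : 4 ≤ m))
    exact div_le_div_of_nonneg_right this (by positivity)
  · -- the target `(m − 4)/N ≤ (S + 1)/N ≤ Q/N` is within the doubling range
    refine G.le_dbl_of_le_two_pow hstart ?_
    have hcast : ((((((m : ℤ) : ℚ) / (Ngrid n : ℚ)) - (4 : ℚ) / (Ngrid n : ℚ) : ℚ)) : ℝ) = ((m : ℝ) - 4) / Ngrid n := by
      push_cast; ring
    rw [hcast]
    have hQN : (2 : ℝ) ^ LQ n / Ngrid n ≤ (2 : ℝ) ^ Tdbl n * (7 / 8) := by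
      have hT : Tdbl n = (LQ n - aN n) + 1 := rfl
      rw [Ngrid_real, hT, pow_succ, div_le_iff₀ (by positivity)]
      have e : (2 : ℝ) ^ LQ n = 2 ^ (LQ n - aN n) * 2 ^ aN n := by
        rw [← pow_add, Nat.sub_add_cancel]; unfold LQ aN; omega
      rw [e]
      have : (0 : ℝ) ≤ 2 ^ (LQ n - aN n) * 2 ^ aN n := by positivity
      nlinarith
    refine le_trans ?_ hQN
    apply div_le_div_of_nonneg_right _ hN0.le
    rw [abs_lt] at hm
    nlinarith
  · -- `|m/N − R| ≤ 1/N`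
    have hcastx : (((((m : ℤ) : ℚ) / (Ngrid n : ℚ)) : ℚ) : ℝ) = (m : ℝ) / Ngrid n := by push_cast; rfl
    rw [hcastx, Int.cast_one, one_mul]
    have : |(m : ℝ) / Ngrid n - G.R| = |(Ngrid n * G.R) - m| / Ngrid n := by
      rw [abs_sub_comm, ← abs_of_pos hN0, ← abs_div, abs_of_pos hN0]; congr 1; field_simp
    rw [this]
    exact div_le_div_of_nonneg_right hm.le hN0.le
  · -- `1/N + E + 2η < 4/N`
    have hcastΔ : ((((4 : ℚ) / (Ngrid n : ℚ)) : ℚ) : ℝ) = 4 / Ngrid n := by push_cast; rfl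
    rw [hcastΔ]
    have h2N : E + 2 * G.η ≤ 2 / Ngrid n := by
      rw [le_div_iff₀ hN0]; linarith [mul_comm (Ngrid n : ℝ) (E + 2 * G.η)]
    have h34 : (1 : ℝ) / Ngrid n + 2 / Ngrid n < 4 / Ngrid n := by
      rw [← add_div]; exact div_lt_div_of_pos_right (by norm_num) hN0
    linarith
  · -- `4/N + E + η + 1/N < L`
    have hcastΔ : ((((4 : ℚ) / (Ngrid n : ℚ)) : ℚ) : ℝ) = 4 / Ngrid n := by push_cast; rfl
    rw [hcastΔ]
    have h5 : (4 : ℝ) / Ngrid n + 1 / Ngrid n ≤ 5 / 4096 := by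
      rw [← add_div, show (4 : ℝ) + 1 = 5 by norm_num]
      exact div_le_div_of_nonneg_left (by norm_num) (by norm_num) hN
    have hE2 : E + G.η ≤ 2 / 4096 := by
      have : (Ngrid n : ℝ) * (E + G.η) ≤ 2 := by nlinarith
      rw [le_div_iff₀ (by norm_num)]; nlinarith
    linarith

end Acceptance

/-! ### A good candidate is listed; the least accepted candidate is correct -/

section Candidates

/-- **A good candidate is listed** on the success event of pair `i`: if the characters `c, d` of the units
`2i, 2i+1` are the harmonics `ck k, ck l` of a coprime pair `1 ≤ k, l ≤ Kh ≤ S/210`, Legendre's theorem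
gives a convergent numerator `p` of `c/d` with `|S − ⌊pQ/c⌉| < 1`, listed in `allCands`.
[cite: Jozsa2003, §10 Thm. 6 (proof)] [cite: HardyWright2008, Thm. 184] -/
theorem exists_good_cand_gen (n : ℕ) {S : ℝ} (hS : 5000 ≤ S) (hQ3 : 3 * S ^ 2 ≤ (2 : ℝ) ^ LQ n)
    {Kh : ℕ} (hKh : (Kh : ℝ) ≤ S / 210) {ck : ℕ → ℕ}
    (hck : ∀ k ∈ Icc 1 Kh, ck k < 2 ^ LQ n ∧ |((ck k : ℕ) : ℝ) - k * (2 : ℝ) ^ LQ n / S| ≤ 1 / 2)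
    {v : List Bool} {i : ℕ} (hi : i < NPAIRS) {kk : ℕ × ℕ}
    (hkk : kk ∈ ((Icc 1 Kh) ×ˢ (Icc 1 Kh)).filter (fun kl : ℕ × ℕ => Nat.Coprime kl.1 kl.2))
    (hc : hallgrenSS.charOf n v (2 * i) = ck kk.1) (hd : hallgrenSS.charOf n v (2 * i + 1) = ck kk.2) :
    ∃ m ∈ allCands n v, |S - m| < 1 := by
  rw [mem_filter, mem_product] at hkk
  obtain ⟨⟨hk, hl⟩, hcop⟩ := hkk
  obtain ⟨-, hcr⟩ := hck _ hk
  obtain ⟨hdQ, hdr⟩ := hck _ hl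
  rw [mem_Icc] at hk hl
  have hk2 : (kk.1 : ℝ) ≤ Kh := by exact_mod_cast hk.2
  have hl2 : (kk.2 : ℝ) ≤ Kh := by exact_mod_cast hl.2
  have hkS : (kk.1 : ℝ) ≤ S := by linarith only [hk2, hKh, hS]
  have hlS : (kk.2 : ℝ) ≤ S := by linarith only [hl2, hKh, hS]
  -- Legendre: a convergent numerator hits `S` after rounding
  have hqnat : ((2 ^ LQ n : ℕ) : ℝ) = (2 : ℝ) ^ LQ n := by push_cast; ring
  have hq3' : 3 * S ^ 2 ≤ ((2 ^ LQ n : ℕ) : ℝ) := by rw [hqnat]; exact hQ3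
  have hcr' : |(((ck kk.1 : ℕ) : ℤ) : ℝ) - kk.1 * ((2 ^ LQ n : ℕ) : ℝ) / S| ≤ 1 / 2 := by
    push_cast; exact hcr
  have hdr' : |(((ck kk.2 : ℕ) : ℤ) : ℝ) - kk.2 * ((2 ^ LQ n : ℕ) : ℝ) / S| ≤ 1 / 2 := by
    push_cast; exact hdr
  have hdQ' : ((ck kk.2 : ℕ) : ℤ).toNat < 2 ^ LQ n := by rw [Int.toNat_natCast]; exact hdQ
  obtain ⟨p, hp, hpS⟩ := exists_mem_numsOf_round (by linarith only [hS]) hq3' hk.1 hkS hl.1 hlS hcop hcr' hdr' hdQ'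
  rw [Int.toNat_natCast, Int.toNat_natCast] at hp
  -- the candidate `m* = ⌊pQ/c⌉`
  have hcpos : 0 < ck kk.1 := by
    have hk1 : (1 : ℝ) ≤ kk.1 := by exact_mod_cast hk.1
    have hS0 : 0 < S := by linarith only [hS]
    have h1 : (1 : ℝ) ≤ (kk.1 : ℝ) * (2 : ℝ) ^ LQ n / S := by
      rw [le_div_iff₀ hS0]; nlinarith only [hk1, hQ3, hS]
    have : (0 : ℝ) < ck kk.1 := by rw [abs_le] at hcr; linarith only [hcr.1, h1]
    exact_mod_cast this
  refine ⟨rdiv (p * 2 ^ LQ n) (ck kk.1), ?_, ?_⟩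
  · unfold allCands
    rw [List.mem_flatten]
    refine ⟨pairCands n v i, List.mem_map.2 ⟨i, List.mem_range.2 hi, rfl⟩, ?_⟩
    unfold pairCands
    rw [List.mem_map]
    exact ⟨p, by rw [hc, hd]; exact hp, by rw [hc]⟩
  · have hr : ((rdiv (p * 2 ^ LQ n) (ck kk.1) : ℕ) : ℝ) = round ((p : ℝ) * ((2 ^ LQ n : ℕ) : ℝ) / (((ck kk.1 : ℕ) : ℤ) : ℝ)) := by
      have := rdiv_eq_round (a := p * 2 ^ LQ n) hcpos
      push_cast at this ⊢
      exact_mod_cast this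
    rw [hr]; exact hpS

/-- **The selection picks an accepted candidate below any given accepted one** (`minAcc` of the filtered
list is the least accepted candidate). [folklore] -/
theorem minAcc_filter_spec_gen (acc : ℕ → Bool) {ms : List ℕ} {m : ℕ} (hm : m ∈ ms) (hacc : acc m = true) :
    ∃ m₀, minAcc (ms.filter acc) = (true, m₀) ∧ acc m₀ = true ∧ m₀ ≤ m := by
  have hmem : m ∈ ms.filter acc := List.mem_filter.2 ⟨hm, hacc⟩
  have hne : ms.filter acc ≠ [] := List.ne_nil_of_mem hmem
  obtain ⟨m₀, hm₀⟩ := Option.ne_none_iff_exists'.1 (fun h => hne (List.min?_eq_none_iff.1 h))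
  refine ⟨m₀, by rw [minAcc_eq, hm₀], (List.mem_filter.1 (List.min?_mem hm₀)).2, ?_⟩
  exact (List.le_min?_iff hm₀).1 le_rfl m hmem

/-- **On the success event the least accepted candidate is within `10` of `S`**: given a sound acceptance
(accepted candidates are within `10` of `l S`, `l ≥ 1`) and a listed accepted candidate within `1` of `S`,
the least accepted candidate `m₀` has `l = 1` (for `l ≥ 2`, `m₀ ≥ 2S − 10 > S + 1 > m ≥ m₀`).
[cite: Jozsa2003, §10 Thm. 6 (proof: output the smallest such m)] -/
theorem post_correct_gen {S : ℝ} (hS : 5000 ≤ S) (acc : ℕ → Bool)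
    (hsound : ∀ m : ℕ, acc m = true → ∃ l : ℤ, 1 ≤ l ∧ |(m : ℝ) - l * S| ≤ 10)
    {ms : List ℕ} (hgood : ∃ m ∈ ms, acc m = true ∧ |S - m| < 1) :
    ∃ m₀ : ℕ, minAcc (ms.filter acc) = (true, m₀) ∧ |(m₀ : ℝ) - S| ≤ 10 := by
  obtain ⟨m, hmem, hacc, hclose⟩ := hgood
  obtain ⟨m₀, hsel, hacc₀, hle⟩ := minAcc_filter_spec_gen acc hmem hacc
  obtain ⟨l, hl1, hl⟩ := hsound m₀ hacc₀
  -- `l = 1`: `m₀ ≤ m < S + 1` and `m₀ ≥ l S − 10`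
  have hl_eq : l = 1 := by
    by_contra hne1
    have hl2 : (2 : ℝ) ≤ l := by exact_mod_cast (show (2 : ℤ) ≤ l by omega)
    have hm₀R : (m₀ : ℝ) ≤ m := by exact_mod_cast hle
    rw [abs_le] at hl; rw [abs_lt] at hclose
    have hlS : 2 * S ≤ l * S := mul_le_mul_of_nonneg_right hl2 (by linarith only [hS])
    linarith only [hl.1, hclose.1, hm₀R, hlS, hS]
  subst hl_eq
  rw [Int.cast_one, one_mul] at hl
  exact ⟨m₀, hsel, hl⟩

end Candidates

/-! ### The post-processor is polynomial time -/

section FP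

/-- A `CodeFP` map into a code read as a string. [folklore] -/
theorem codeFP_toStr_gen {α β : Type} {eα : α → List Bool} {eβ : β → List Bool} {f : α → β} (h : CodeFP eα eβ f) :
    CodeFP eα strE (fun a => eβ (f a)) := by
  obtain ⟨F, hF, hFe⟩ := h; exact ⟨F, hF, hFe⟩

variable {passes : List Bool → ℕ → Bool} (hpasses : CodeFP (pairE strE natE) bitE (fun p => passes p.1 p.2))
include hpasses

/-- The acceptance of a candidate (`12 ≤ m` and the test) is polynomial time. [folklore] -/
theorem acc_str_gen : CodeFP (pairE strE natE) bitE (fun p => decide (12 ≤ p.2) && passes p.1 p.2) := by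
  have h12 : CodeFP (pairE strE natE) bitE (fun p => decide (12 ≤ p.2)) := (natLe.comp ((const _ 12).pair (snd _ _)) :)
  exact ((h12.and hpasses) :).congr fun p => rfl

/-- **The least accepted candidate is polynomial time** (filter, then the min-fold `minAcc`).
[cite: Jozsa2003, §10 Thm. 6 (proof: every classical step is poly(log S))] -/
theorem sel_str_gen : CodeFP (pairE strE (rawE natE)) (pairE bitE natE)
    (fun p => minAcc (p.2.filter (fun m => decide (12 ≤ m) && passes p.1 m))) := by
  have hflt : CodeFP (pairE strE (rawE natE)) (rawE natE) (fun p => p.2.filter (fun m => decide (12 ≤ m) && passes p.1 m)) :=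
    (filter (acc_str_gen hpasses) :)
  -- the min-fold (no context needed): item `m`, accumulator `(flag, value)`
  have hstep : CodeFP (pairE natE (pairE bitE natE)) (pairE bitE natE) (fun t => ((true : Bool), if t.2.1 then min t.2.2 t.1 else t.1)) := by
    have hb : CodeFP (pairE natE (pairE bitE natE)) bitE (fun t => t.2.1) := (snd _ _).fst'
    have hk : CodeFP (pairE natE (pairE bitE natE)) natE (fun t => t.2.2) := (snd _ _).snd'
    have hm : CodeFP (pairE natE (pairE bitE natE)) natE (fun t => t.1) := fst _ _
    have hmin : CodeFP (pairE natE (pairE bitE natE)) natE (fun t => min t.2.2 t.1) := (natMin.comp (hk.pair hm) :)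
    have hv : CodeFP (pairE natE (pairE bitE natE)) natE (fun t => if t.2.1 then min t.2.2 t.1 else t.1) := hb.ite hmin hm
    exact ((const _ true).pair hv :)
  have hfold := foldl₀ (eα := natE) (eβ := pairE bitE natE)
    (step := fun (m : ℕ) (a : Bool × ℕ) => ((true : Bool), if a.1 then min a.2 m else m)) (b₀ := ((false : Bool), 0)) hstep (X + 8)
    (fun l₁ l₂ => by
      simp only [eval_add, eval_X, eval_ofNat]
      -- the value is `0` or an element of `l₁`
      have hmem : ∀ (l : List ℕ) (a : Bool × ℕ), (l.foldl (fun b a' => ((true : Bool), if b.1 then min b.2 a' else a')) a).2 = a.2 ∨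
          (l.foldl (fun b a' => ((true : Bool), if b.1 then min b.2 a' else a')) a).2 ∈ l := by
        intro l
        induction l with
        | nil => intro a; left; rfl
        | cons m l ih =>
          intro a
          rw [List.foldl_cons]
          rcases ih ((true : Bool), if a.1 then min a.2 m else m) with h | h
          · rw [h]
            simp only
            split_ifs with hb
            · rcases Nat.le_total a.2 m with hh | hh
              · left; exact min_eq_left hh
              · right; rw [min_eq_right hh]; exact List.mem_cons_self
            · right; exact List.mem_cons_self
          · right; exact List.mem_cons_of_mem _ h
      have hval : (natE (l₁.foldl (fun b a' => ((true : Bool), if b.1 then min b.2 a' else a')) ((false : Bool), 0)).2).length ≤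
          (rawE natE (l₁ ++ l₂)).length := by
        rcases hmem l₁ ((false : Bool), 0) with h | h
        · rw [h]; simp
        · have := length_item_le_length_rawE natE (List.mem_append_left l₂ h); omega
      rw [pairE_apply, length_boolPair]
      have : (bitE (l₁.foldl (fun b a' => ((true : Bool), if b.1 then min b.2 a' else a')) ((false : Bool), 0)).1).length = 1 := rfl
      omega)
  have h := (hfold.comp hflt :)
  exact h.congr fun p => rfl

/-- **The post-processor is polynomial time**: `⟨w, v⟩ ↦ ⟨bin m₀, ε⟩` for the least accepted candidate `m₀`
of `allCands |w| v`, empty if none is accepted. [cite: Jozsa2003, §10 Thm. 6 (proof) and Thm. 7] -/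
theorem post_str_gen : CodeFP (pairE strE strE) strE (fun c =>
    if (minAcc ((allCands c.1.length c.2).filter (fun m => decide (12 ≤ m) && passes c.1 m))).1 then
      boolPair (encodeNat (minAcc ((allCands c.1.length c.2).filter (fun m => decide (12 ≤ m) && passes c.1 m))).2) []
    else []) := by
  have hx : CodeFP (pairE strE strE) strE (fun c => c.1) := fst _ _
  have hsel : CodeFP (pairE strE strE) (pairE bitE natE)
      (fun c => minAcc ((allCands c.1.length c.2).filter (fun m => decide (12 ≤ m) && passes c.1 m))) :=
    ((sel_str_gen hpasses).comp (hx.pair allCands_str) :)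
  have hb : CodeFP (pairE strE strE) bitE
      (fun c => (minAcc ((allCands c.1.length c.2).filter (fun m => decide (12 ≤ m) && passes c.1 m))).1) := hsel.fst'
  have hm : CodeFP (pairE strE strE) natE
      (fun c => (minAcc ((allCands c.1.length c.2).filter (fun m => decide (12 ≤ m) && passes c.1 m))).2) := hsel.snd'
  have hout : CodeFP (pairE strE strE) strE
      (fun c => boolPair (encodeNat (minAcc ((allCands c.1.length c.2).filter (fun m => decide (12 ≤ m) && passes c.1 m))).2) []) :=
    (codeFP_toStr_gen (hm.pair (const _ ([] : List Bool))) : CodeFP (pairE strE strE) strE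
      (fun c => pairE natE strE ((minAcc ((allCands c.1.length c.2).filter (fun m => decide (12 ≤ m) && passes c.1 m))).2, [])))
  exact hb.ite hout (const _ [])

/-- **The post-processor as a string function of `⟨w, v⟩`.** [cite: BernsteinVazirani1997, §8] -/
theorem exists_post_fn_gen : ∃ g : List Bool → List Bool, g ∈ FP ∧ ∀ w v : List Bool, g (boolPair w v) =
    if (minAcc ((allCands w.length v).filter (fun m => decide (12 ≤ m) && passes w m))).1 then
      boolPair (encodeNat (minAcc ((allCands w.length v).filter (fun m => decide (12 ≤ m) && passes w m))).2) []
    else [] := by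
  obtain ⟨g, hg, hge⟩ := post_str_gen hpasses
  refine ⟨g, hg, fun w v => ?_⟩
  have h := hge (w, v)
  -- normalise the codes syntactically (never unfold `allCands`: it is a huge closed computation)
  simp only [pairE_apply, strE, id_eq] at h
  exact h

end FP

end HallgrenQuantum

end Literature.Computability.Cryptography

end
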